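import Literature.Probability.Percolation.InterfaceScalingLimitProofs
import Literature.Probability.Percolation.CLE6Proofs
import Literature.Probability.Percolation.TriAnnulusCrossingProofs
import HarnessLib

/-!
# Tightness of the critical site-percolation interface on `δ𝕋`: reduction to one percolation estimate

Topic: Probability / Percolation. Companion of `InterfaceScalingLimitProofs.lean` (the bond-`ℤ²`
case) for the **hexagonal exploration path of critical site percolation on the triangular
lattice**: this file reduces the tightness statement **crit-perc.S26** (triangular case),
`Literature.Probability.Percolation.isTightLaws_map_triInterface` (`InterfaceScalingLimit.lean`;
Aizenman–Burchard, Duke Math. J. 99 (1999), Thm 1.2 with Appendix A; invoked for the exploration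
path by Camia–Newman, PTRF 139 (2007), §5: "the existence of subsequential limits for the
percolation exploration path, which follows from the work of Aizenman and Burchard"), to a single
named percolation-side fact, via the abstract Aizenman–Burchard criterion
`Literature.Probability.RandomPlanarGeometry.isTightMeasureSet_of_traversalBounds`
(`CurveTightness.lean`, AB99 Thms 1.1–1.2):

* `triExploration_shortDistanceCutoff` (C0, lattice geometry, AB99 §1.a "short-distance
  cutoff"): at mesh `δ ∈ (0, 1]` the exploration polygon stays in a fixed disc and never
  traverses a shell of inner radius `≤ δ` more than a fixed number `k₀` of times.
  **Proved** (`triExploration_shortDistanceCutoff_holds`): the exploration path is a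
  self-avoiding walk of the hexagonal lattice (`IsExplorationPath.isPath`), so no dart is
  repeated, and only boundedly many darts of `δH` live near a ball of radius `≤ δ`
  (`not_hasTraversals_toCurve_of_isPath`).
* (C1, the percolation estimate, AB99 hypothesis H1 / App. A with a boundary-dependent
  threshold, exactly as `bondExploration_traversalBound`): an **explicit hypothesis** `h1` of the
  reduction theorems (no named fact is vendored, D-0026); it is proved in the sequel files
  (Russo–Seymour–Welsh on `𝕋`, van den Berg–Kesten, and the sector bookkeeping of AB99 App. A).
* `isTightMeasureSet_map_triInterface_of_le` (Clarge): the interface laws with mesh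
  `δ ∈ [δ₀, 1]` form a tight family. **Proved** (`isTightMeasureSet_map_triInterface_of_le_holds`).

The assembly `isTightLaws_map_triInterface_of_traversalBounds` (from C0, C1, Clarge) and its
corollary `isTightLaws_map_triInterface_of_traversalBound` (from C1 alone) are proved here; the
generic bookkeeping (`HasOrdConnectedCover`, `segMeetCount`, …) is imported from the bond file.

On the junk value of `explorationCurve`: G02's curve is the polygon of the exploration walk when
the exploration path exists uniquely and the constant curve `0` otherwise
(`LatticeModels.explorationWalk`); a constant curve traverses no shell, and in the other case the
chosen walk *is* an exploration path (`isExplorationPath_of_explorationWalk_eq_some`), which is all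
the geometry below uses — no appeal to `existsUnique_explorationPath` is made.

## References

* M. Aizenman, A. Burchard, *Hölder regularity and dimension bounds for random curves*, Duke
  Math. J. 99 (1999) 419–453, Thms 1.1–1.2, §1.a, hypothesis H1 (1.3), Appendix A ("In two
  dimensions, our hypotheses H1 and H2 are satisfied by the independent bond, site, and droplet
  percolation models … RSW … van den Berg–Kesten").
* F. Camia, C. M. Newman, *Critical percolation exploration path and SLE₆: a proof of
  convergence*, Probab. Theory Related Fields 139 (2007), §3.1 and §5.
* S. Smirnov, *Critical percolation in the plane*, C. R. Acad. Sci. Paris 333 (2001), §2.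
-/

noncomputable section

open MeasureTheory Filter Metric Set
open _root_.Topology
open scoped unitInterval ENNReal

/-! ### Darts of a walk as consecutive pairs of its support -/

namespace SimpleGraph.Walk

variable {V : Type*} {G : SimpleGraph V}

/-- The list of (tail, head) pairs of the darts of a walk is the list of consecutive pairs of its
support (a deliberate dot-notation extension of Mathlib's `SimpleGraph.Walk` namespace).
[folklore] -/
theorem map_darts_eq_zip_support :
    ∀ {u v : V} (w : G.Walk u v), w.darts.map (fun d ↦ (d.fst, d.snd)) = w.support.zip w.support.tail
  | _, _, .nil => by simp
  | _, _, .cons h w => by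
    rw [darts_cons, List.map_cons, support_cons, List.tail_cons, map_darts_eq_zip_support w]
    obtain ⟨t, ht⟩ : ∃ t, w.support = _ :: t := ⟨w.support.tail, w.cons_tail_support.symm⟩
    rw [ht]
    rfl

/-- A consecutive pair of the support of a walk is a dart of the walk. [folklore] -/
theorem exists_dart_of_mem_zip_support {u v : V} (w : G.Walk u v) {p : V × V}
    (hp : p ∈ w.support.zip w.support.tail) : ∃ d ∈ w.darts, d.fst = p.1 ∧ d.snd = p.2 := by
  rw [← map_darts_eq_zip_support] at hp
  obtain ⟨d, hd, rfl⟩ := List.mem_map.1 hp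
  exact ⟨d, hd, rfl, rfl⟩

end SimpleGraph.Walk

namespace Literature.Probability.Percolation

section CritPerc

open LatticeModels

/-! ### The exploration polygon as a parametrised curve -/

/-- The hexagonal exploration polygon of the site configuration `ω` on `δ𝕋` in the Dobrushin
domain `D` (G02's `explorationCurve (dobrushinData D δ) ω`: the polyline through the rescaled
centres of the faces visited by the exploration walk, junk constant `0` when the exploration path
is not uniquely defined), as a `Curve ℂ` — i.e. before re-orientation (`orientCurve`) and before
passing to the quotient `CurveClass ℂ` (`triInterface`). (Smirnov 2001, §2; Camia–Newman 2007,
§3.1.) [cite: Smirnov2001, §2] -/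
def triExplorationCurve (D : RandomPlanarGeometry.DobrushinDomain) (δ : ℝ) (ω : SiteConfig (Site 2)) :
    RandomPlanarGeometry.Curve ℂ :=
  ⟨explorationCurve (dobrushinData D δ) ω⟩

/-- `triInterface D δ` is the class of the re-oriented exploration curve (definitional).
(Smirnov 2001, §2.) [cite: Smirnov2001, §2] -/
theorem triInterface_eq_comp (D : RandomPlanarGeometry.DobrushinDomain) (δ : ℝ) :
    triInterface D δ =
      RandomPlanarGeometry.CurveClass.mk ∘ fun ω ↦ orientCurve D (explorationCurve (dobrushinData D δ) ω) :=
  rfl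

/-- Case analysis on G02's exploration curve: it is the junk constant curve `0`, or the polygon
of a genuine exploration path (a walk of the hexagonal lattice satisfying `IsExplorationPath`).
(Smirnov 2001, §2.) [cite: Smirnov2001, §2] -/
theorem explorationCurve_eq_const_or (Dd : DiscreteDobrushin) (ω : SiteConfig (Site 2)) :
    explorationCurve Dd ω = ContinuousMap.const _ 0 ∨
      ∃ (f g : HexVertex) (w : hexGraph.Walk f g), IsExplorationPath Dd ω w ∧
        explorationCurve Dd ω = w.toCurve fun f ↦ (Dd.δ : ℂ) * hexCenter f := by
  unfold explorationCurve
  cases h : explorationWalk Dd ω with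
  | none => exact Or.inl rfl
  | some γ =>
    exact Or.inr ⟨γ.1, γ.2.1, γ.2.2, isExplorationPath_of_explorationWalk_eq_some h, rfl⟩

/-! ### The three percolation-side inputs -/

/-- **(C0) Short-distance cutoff of the hexagonal exploration polygon** (lattice geometry; the
hypothesis "(H0)" of `isTightMeasureSet_of_traversalBounds`). For every Dobrushin domain `D`
there are a radius `r₀` and a number `k₀` such that for every mesh `δ ∈ (0, 1]` and *every*
configuration `ω`: the exploration polygon `triExplorationCurve D δ ω` lies in the disc
`closedBall 0 r₀` (its vertices are centres of faces of `δ𝕋` bordering edges of `Ω_δ ⊆ Ω`, a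
bounded set, or it is the junk constant `0`), and no shell `D(x; ρ, R)` with inner radius
`ρ ≤ δ` (`0 < ρ < R`) is traversed by `k₀` separate segments of it (the polygon is a self-avoiding
walk of the hexagonal lattice `δH`, so boundedly many of its edges meet `closedBall x δ`, and
along each edge at most two separate traversals can start or end). This is the "short-distance
cutoff `δ`" of Aizenman–Burchard, Duke Math. J. 99 (1999), §1.a, made quantitative.
[cite: AizenmanBurchardDuke1999, §1.a] -/
def triExploration_shortDistanceCutoff : Prop :=
  ∀ D : RandomPlanarGeometry.DobrushinDomain, ∃ (r₀ : ℝ) (k₀ : ℕ), 0 ≤ r₀ ∧ ∀ δ ∈ Set.Ioc (0 : ℝ) 1,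
    ∀ ω : SiteConfig (Site 2), (triExplorationCurve D δ ω).range ⊆ closedBall 0 r₀ ∧
      ∀ (x : ℂ) (ρ R : ℝ), 0 < ρ → ρ ≤ δ → ρ < R →
        ¬ (triExplorationCurve D δ ω).HasTraversals k₀ x ρ R

/-!
**(C1) Power bound on multiple shell crossings by the hexagonal exploration path** — hypothesis
H1 of Aizenman–Burchard, Duke Math. J. 99 (1999), eq. (1.3), for the exploration path of
critical site percolation `P_{1/2}` on `δ𝕋` in a Dobrushin domain, in the tree's formulation
with a shell-dependent threshold and for small mesh only (word for word the triangular twin of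
`bondExploration_traversalBound`): for every Dobrushin domain `D` there are a threshold
`k : ℂ → ℝ → ℝ → ℕ` (independent of the mesh), constants `K ≥ 0`, `λ > 2` and a mesh bound
`δ₀ > 0` such that for every mesh `δ ∈ (0, δ₀]` at which the discretisation `dobrushinData D δ`
is admissible (`IsAdmissible`) and all shells with `δ ≤ ρ < R ≤ 1`,
`P_{1/2}(D(x; ρ, R) is traversed by k(x, ρ, R) separate segments of γ_δ) ≤ K (ρ / R)^λ`.

Under the fact-decomposition discipline (D-0026) this statement is **not** vendored as a named
fact: it enters the two reduction theorems below as the explicit hypothesis `h1` (spelled out in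
full), and is proved outright in the sequel (`triExploration_traversalBound`, whence
`isTightLaws_map_triInterface_holds`). Content (AB99, Appendix A: "In two dimensions, our
hypotheses H1 and H2 are satisfied by the independent bond, site, and droplet percolation models.
The `k = 1` case … is a particular implication of the Russo–Seymour–Welsh theory. The statement
that `λ(k) → ∞` follows by the van den Berg–Kesten inequality"): the `k` traversing segments cut
the shell into sectors, each containing a monochromatic crossing of `D(x; ρ + 2δ, R - 2δ)` by
sites of `δ𝕋` running alongside the path (open hexagons on its left, closed ones on its right,
Smirnov 2001, §2); those made of interior sites of `Ω_δ` are disjoint crossings of probability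
`≤ ((ρ/R)^{α})^j` by the annulus bound `tri_annulusCrossing_bound` (Bollobás–Riordan 2006, Ch. 7
Lemma 4) and the BK inequality; the threshold `k(x, ρ, R)` absorbs the sectors whose crossing is
supplied by the frozen boundary hexagons (arc `A` open, arc `B` closed) — see the module
docstring of `InterfaceScalingLimitProofs.lean` for why a constant threshold would be false near
the marked points of a general Jordan domain.
-/

/-- **(Clarge) Tightness away from `δ = 0`.** For every Dobrushin domain `D` and every `δ₀ > 0`,
the laws `(P_{1/2}).map (triInterface D δ)`, `δ ∈ [δ₀, 1]`, form a tight set of measures on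
`CurveClass ℂ`: at mesh `δ ≥ δ₀` every face bordering an edge of the bounded `Ω_δ` has its cell in
a fixed box, so no exploration polygon traverses any shell more than a fixed number of times
(proved below, `isTightMeasureSet_map_triInterface_of_le_holds`). (Aizenman–Burchard 1999, §1.a:
only the limit `δ → 0` is at stake.) [cite: AizenmanBurchardDuke1999, §1.a] -/
def isTightMeasureSet_map_triInterface_of_le : Prop :=
  ∀ (D : RandomPlanarGeometry.DobrushinDomain) (δ₀ : ℝ), 0 < δ₀ →
    IsTightMeasureSet
      ((fun δ ↦ (triSitePercolation half).map (triInterface D δ)) '' Set.Icc δ₀ 1)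

/-! ### The assembly -/

/-- Eventual admissibility along `𝓝[>] 0` gives a threshold `δ₁ > 0` below which all meshes are
admissible. (Smirnov 2001, §2: proper discretisations for small mesh.) [cite: Smirnov2001, §2] -/
theorem exists_forall_isAdmissible_of_eventually {D : RandomPlanarGeometry.DobrushinDomain}
    (hD : ∀ᶠ δ in 𝓝[>] (0 : ℝ), (dobrushinData D δ).IsAdmissible) :
    ∃ δ₁ > 0, ∀ δ, 0 < δ → δ < δ₁ → (dobrushinData D δ).IsAdmissible := by
  rw [eventually_nhdsWithin_iff, Metric.eventually_nhds_iff] at hD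
  obtain ⟨ε, hε, h⟩ := hD
  refine ⟨ε, hε, fun δ hδ hδε ↦ h ?_ hδ⟩
  rwa [Real.dist_eq, sub_zero, abs_of_pos hδ]

/-- **Tightness of the triangular interface near `δ = 0` from (C0) and (C1)**, by the
Aizenman–Burchard criterion `isTightMeasureSet_of_traversalBounds` applied in `E = ℂ` with
`Λ = closedBall 0 r₀` (covering exponent `d = 2`, `exists_finset_card_le_cover_closedBall`),
the random curves `X_δ = orientCurve D (explorationCurve (dobrushinData D δ) ·)` (whose classes
are `triInterface D δ`, and whose traversal counts and traces are those of the exploration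
polygon, `hasTraversals_orientCurve_iff`), the threshold `max k₀ (k x ρ R)` and the index set
`T = (0, δ₂]` of small admissible meshes (`δ₂ ≤ min δ₀ 1`). (Aizenman–Burchard 1999, Thm 1.2.)
[cite: AizenmanBurchardDuke1999, Thm 1.2] -/
theorem exists_isTightMeasureSet_map_triInterface_of_traversalBounds
    (h0 : triExploration_shortDistanceCutoff)
    (h1 : ∀ D : RandomPlanarGeometry.DobrushinDomain, ∃ (k : ℂ → ℝ → ℝ → ℕ) (K lam δ₀ : ℝ),
      0 ≤ K ∧ 2 < lam ∧ 0 < δ₀ ∧ ∀ δ ∈ Set.Ioc (0 : ℝ) δ₀, (dobrushinData D δ).IsAdmissible →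
        ∀ (x : ℂ) (ρ R : ℝ), δ ≤ ρ → ρ < R → R ≤ 1 →
          triSitePercolation half {ω | (triExplorationCurve D δ ω).HasTraversals (k x ρ R) x ρ R} ≤
            ENNReal.ofReal (K * (ρ / R) ^ lam))
    (D : RandomPlanarGeometry.DobrushinDomain) :
    ∃ δ₃ > 0, ∀ δ₂, δ₂ ≤ δ₃ → (∀ δ, 0 < δ → δ ≤ δ₂ → (dobrushinData D δ).IsAdmissible) →
      IsTightMeasureSet
        ((fun δ ↦ (triSitePercolation half).map (triInterface D δ)) '' Set.Ioc 0 δ₂) := by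
  obtain ⟨r₀, k₀, hr₀, hcut⟩ := h0 D
  obtain ⟨k, K, lam, δ₀, hK, hlam, hδ₀, hbd⟩ := h1 D
  refine ⟨min δ₀ 1, lt_min hδ₀ one_pos, fun δ₂ hδ₂ hadm ↦ ?_⟩
  have hT : Set.Ioc 0 δ₂ ⊆ Set.Ioc (0 : ℝ) 1 :=
    Set.Ioc_subset_Ioc_right (hδ₂.trans (min_le_right _ _))
  have hT₀ : Set.Ioc 0 δ₂ ⊆ Set.Ioc (0 : ℝ) δ₀ :=
    Set.Ioc_subset_Ioc_right (hδ₂.trans (min_le_left _ _))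
  have key := RandomPlanarGeometry.isTightMeasureSet_of_traversalBounds (E := ℂ)
    (isCompact_closedBall (0 : ℂ) r₀) (C := 9 * (r₀ + 2) ^ 2) (d := 2) zero_le_two
    (fun ρ hρ hρ1 ↦ RandomPlanarGeometry.exists_finset_card_le_cover_closedBall hr₀ ρ hρ hρ1)
    (Ω := fun _ ↦ SiteConfig (Site 2)) (fun _ ↦ triSitePercolation half)
    (fun δ ω ↦ orientCurve D (explorationCurve (dobrushinData D δ) ω))
    (fun x ρ R ↦ max k₀ (k x ρ R)) hK hlam hT ?_ ?_
  · simpa only [triInterface_eq_comp] using key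
  · -- (H0) from (C0), for every `ω`
    intro δ hδ
    refine ae_of_all _ fun ω ↦ ⟨?_, fun x ρ R hρ hρδ hρR htr ↦ ?_⟩
    · rw [curveRange_orientCurve]
      exact (hcut δ (hT hδ) ω).1
    · rw [hasTraversals_orientCurve_iff] at htr
      exact (hcut δ (hT hδ) ω).2 x ρ R hρ hρδ hρR (htr.of_le (le_max_left _ _))
  · -- (H1) from (C1)
    intro δ hδ x ρ R hδρ hρR hR1
    refine le_trans (measure_mono fun ω hω ↦ ?_)
      (hbd δ (hT₀ hδ) (hadm δ hδ.1 hδ.2) x ρ R hδρ hρR hR1)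
    simp only [mem_setOf_eq, hasTraversals_orientCurve_iff] at hω ⊢
    exact hω.of_le (le_max_right _ _)

/-- **Assembly: crit-perc.S26 for site percolation on `𝕋` from (C0), (C1), (Clarge).** The
interface laws for `δ ∈ (0, 1]` split into `δ ∈ (0, δ₂]`, where the discretisations are
admissible (eventual admissibility is the hypothesis of `isTightLaws_map_triInterface`), the
meshes are small and `exists_isTightMeasureSet_map_triInterface_of_traversalBounds` applies, and
`δ ∈ [δ₂, 1]`, covered by (Clarge); a union of two tight sets is tight. (Aizenman–Burchard 1999,
Thm 1.2, triangular case, single-interface half of S26.) [cite: AizenmanBurchardDuke1999, Thm 1.2] -/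
theorem isTightLaws_map_triInterface_of_traversalBounds
    (h0 : triExploration_shortDistanceCutoff)
    (h1 : ∀ D : RandomPlanarGeometry.DobrushinDomain, ∃ (k : ℂ → ℝ → ℝ → ℕ) (K lam δ₀ : ℝ),
      0 ≤ K ∧ 2 < lam ∧ 0 < δ₀ ∧ ∀ δ ∈ Set.Ioc (0 : ℝ) δ₀, (dobrushinData D δ).IsAdmissible →
        ∀ (x : ℂ) (ρ R : ℝ), δ ≤ ρ → ρ < R → R ≤ 1 →
          triSitePercolation half {ω | (triExplorationCurve D δ ω).HasTraversals (k x ρ R) x ρ R} ≤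
            ENNReal.ofReal (K * (ρ / R) ^ lam))
    (hL : isTightMeasureSet_map_triInterface_of_le) : isTightLaws_map_triInterface := by
  intro D hD
  obtain ⟨δ₁, hδ₁, hadm⟩ := exists_forall_isAdmissible_of_eventually hD
  obtain ⟨δ₃, hδ₃, hsmall⟩ := exists_isTightMeasureSet_map_triInterface_of_traversalBounds h0 h1 D
  set δ₂ : ℝ := min (δ₁ / 2) δ₃ with hδ₂
  have hδ₂pos : 0 < δ₂ := lt_min (by positivity) hδ₃
  have hδ₂lt : δ₂ < δ₁ := (min_le_left _ _).trans_lt (by linarith)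
  have hsmall' := hsmall δ₂ (min_le_right _ _) fun δ hδ hδle ↦ hadm δ hδ (hδle.trans_lt hδ₂lt)
  have hlarge := hL D δ₂ hδ₂pos
  refine (hsmall'.union hlarge).subset ?_
  rw [← Set.image_union]
  refine Set.image_mono fun δ hδ ↦ ?_
  rcases le_or_gt δ δ₂ with h | h
  · exact Or.inl ⟨hδ.1, h⟩
  · exact Or.inr ⟨h.le, hδ.2⟩

/-! ### Counting the darts of the hexagonal lattice near a ball -/

section HexGeometry

/-- The box of cells of half-width `n` about the site `c` (a finite set of `(2n + 1)²` sites).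
[folklore] -/
def hexCellBox (c : Site 2) (n : ℕ) : Finset (Site 2) :=
  Fintype.piFinset fun i ↦ Finset.Icc (c i - n) (c i + n)

/-- Membership in the cell box: every coordinate is within `n` of that of `c`. [folklore] -/
theorem mem_hexCellBox {c : Site 2} {n : ℕ} {x : Site 2} :
    x ∈ hexCellBox c n ↔ ∀ i, |x i - c i| ≤ n := by
  simp only [hexCellBox, Fintype.mem_piFinset, Finset.mem_Icc, abs_sub_le_iff]
  refine forall_congr' fun i ↦ ?_
  omega

/-- The cell box has `(2n + 1)²` elements. [folklore] -/
theorem card_hexCellBox (c : Site 2) (n : ℕ) : (hexCellBox c n).card = (2 * n + 1) ^ 2 := by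
  rw [hexCellBox, Fintype.card_piFinset, Fin.prod_univ_two, Int.card_Icc, Int.card_Icc]
  have h : ∀ i, (c i + n + 1 - (c i - n)).toNat = 2 * n + 1 := fun i ↦ by omega
  rw [h 0, h 1, sq]

/-- The pairs of faces of `𝕋` (vertices of the hexagonal lattice) whose cells both lie in the box
of half-width `n` about `c` (a finite set of `(2 (2n + 1)²)²` pairs, containing every dart of the
hexagonal lattice near `c`). (Counting device for the short-distance cutoff, AB99 §1.a.)
[cite: AizenmanBurchardDuke1999, §1.a] -/
def hexDartBox (c : Site 2) (n : ℕ) : Finset (HexVertex × HexVertex) :=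
  (hexCellBox c n ×ˢ (Finset.univ : Finset (Fin 2))) ×ˢ (hexCellBox c n ×ˢ (Finset.univ : Finset (Fin 2)))

/-- The dart box has `(2 (2n + 1)²)²` elements. [folklore] -/
theorem card_hexDartBox (c : Site 2) (n : ℕ) :
    (hexDartBox c n).card = ((2 * n + 1) ^ 2 * 2) ^ 2 := by
  rw [hexDartBox, Finset.card_product, Finset.card_product, card_hexCellBox, Finset.card_univ,
    Fintype.card_fin]
  ring

/-- Pairs of faces with cells in the box belong to the dart box. [folklore] -/
theorem mem_hexDartBox {c : Site 2} {n : ℕ} {f g : HexVertex} (hf : ∀ i, |f.1 i - c i| ≤ n)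
    (hg : ∀ i, |g.1 i - c i| ≤ n) : (f, g) ∈ hexDartBox c n := by
  simp only [hexDartBox, Finset.mem_product, Finset.mem_univ, and_true]
  exact ⟨mem_hexCellBox.2 hf, mem_hexCellBox.2 hg⟩

/-- `‖ζ‖ = 1` for the sixth root of unity `ζ = e^{iπ/3}` (private copy of
`SmirnovSeparatingData.norm_triZeta`, to keep the import closure small). [folklore] -/
private theorem norm_triZeta_eq_one : ‖triZeta‖ = 1 := by
  have h := normSq_triZeta
  rw [Complex.normSq_eq_norm_sq] at h
  nlinarith [norm_nonneg triZeta, h]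

/-- The centre of a face is within `2` of the lattice point of its cell (in fact within `2/√3`).
[folklore] -/
theorem norm_hexCenter_sub_triEmbed_le (F : HexVertex) : ‖hexCenter F - triEmbed F.1‖ ≤ 2 := by
  have h1 : ‖(1 : ℂ) + triZeta‖ ≤ 2 := by
    refine (norm_add_le _ _).trans ?_
    rw [norm_one, norm_triZeta_eq_one]
    norm_num
  have h2 : ‖((F.2 : ℕ) + 1 : ℂ)‖ ≤ 2 := by
    have : ((F.2 : ℕ) + 1 : ℂ) = ((F.2 : ℕ) + 1 : ℕ) := by push_cast; ring
    rw [this, Complex.norm_natCast]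
    have := F.2.is_lt
    norm_cast
  have hoff : hexCenter F - triEmbed F.1 = ((F.2 : ℕ) + 1 : ℂ) * (1 + triZeta) / 3 := by
    rw [hexCenter]; ring
  rw [hoff, norm_div, norm_mul, Complex.norm_ofNat]
  have := mul_le_mul h2 h1 (norm_nonneg _) zero_le_two
  linarith

/-- **Cells are controlled by the distance of the centre**: if the centre of the face `F` is
within `K` of the lattice point `triEmbed c` and `2 (K + 2) ≤ n`, then the cell of `F` lies in the
box of half-width `n` about `c` (`abs_le_two_mul_norm_triEmbed`). [folklore] -/
theorem abs_sub_le_of_norm_hexCenter_sub_le {F : HexVertex} {c : Site 2} {K : ℝ} {n : ℕ}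
    (h : ‖hexCenter F - triEmbed c‖ ≤ K) (hn : 2 * (K + 2) ≤ n) (i : Fin 2) :
    |F.1 i - c i| ≤ (n : ℤ) := by
  have hF := norm_hexCenter_sub_triEmbed_le F
  have hsub : ‖triEmbed (F.1 - c)‖ ≤ K + 2 := by
    rw [triEmbed_sub]
    have : triEmbed F.1 - triEmbed c = (hexCenter F - triEmbed c) - (hexCenter F - triEmbed F.1) := by
      ring
    rw [this]
    exact (norm_sub_le _ _).trans (by linarith)
  have hcoord := abs_le_two_mul_norm_triEmbed (F.1 - c) i
  have hreal : |((F.1 i - c i : ℤ) : ℝ)| ≤ (n : ℝ) := by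
    have : ((F.1 - c) i : ℝ) = ((F.1 i - c i : ℤ) : ℝ) := by simp
    rw [← this]
    linarith
  have : (((|F.1 i - c i| : ℤ)) : ℝ) ≤ ((n : ℤ) : ℝ) := by
    rw [Int.cast_abs]
    exact_mod_cast hreal
  exact_mod_cast this

/-- Mesh points at distance `≤ K δ` come from lattice points at distance `≤ K`. [folklore] -/
theorem norm_triEmbed_sub_le_of_triMeshPoint {δ : ℝ} (hδ : 0 < δ) {v c : Site 2} {K : ℝ}
    (h : ‖triMeshPoint δ v - triMeshPoint δ c‖ ≤ K * δ) : ‖triEmbed v - triEmbed c‖ ≤ K := by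
  rw [triMeshPoint, triMeshPoint, ← mul_sub, norm_mul, Complex.norm_real, Real.norm_eq_abs,
    abs_of_pos hδ, mul_comm] at h
  exact le_of_mul_le_mul_right h hδ

/-- **The two faces of an exploration step are close to a site of the discrete domain**: the
tail `v` of the crossed dart of `𝕋` is a site of `Ω_δ` with both face centres within `δ` of its
mesh point (and within `1` of `triEmbed v` in lattice units). (Smirnov 2001, §2.)
[cite: Smirnov2001, §2] -/
theorem _root_.Literature.Probability.LatticeModels.IsExplorationStep.exists_near
    {Dd : DiscreteDobrushin} {ω : SiteConfig (Site 2)} {f g : HexVertex}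
    (h : IsExplorationStep Dd ω f g) (hδ : 0 ≤ Dd.δ) :
    ∃ v ∈ triMeshDomain Dd.Ω Dd.δ,
      (Dd.δ : ℂ) * hexCenter f ∈ closedBall (triMeshPoint Dd.δ v) Dd.δ ∧
      (Dd.δ : ℂ) * hexCenter g ∈ closedBall (triMeshPoint Dd.δ v) Dd.δ ∧
      ‖hexCenter f - triEmbed v‖ ≤ 1 ∧ ‖hexCenter g - triEmbed v‖ ≤ 1 := by
  obtain ⟨e, he, hadj, -, -⟩ := h
  have h1 : (triEdgeFaces e).1 = g := congrArg Prod.fst he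
  have h2 : (triEdgeFaces e).2 = f := congrArg Prod.snd he
  obtain ⟨hb1, hb2⟩ := hexCenter_triEdgeFaces_mem_closedBall hδ e
  obtain ⟨hn1, hn2⟩ := norm_hexCenter_triEdgeFaces_sub_le_one e
  rw [h1] at hb1 hn1
  rw [h2] at hb2 hn2
  exact ⟨e.fst, (triDiscreteDomainGraph_adj_iff.1 hadj).2.1, hb2, hb1, hn2, hn1⟩

/-- A `zip` whose left list has no duplicates has no duplicates (private copy of
`InterfaceSLETightness.nodup_zip_of_nodup_left`, to keep the import closure small). [folklore] -/
private theorem nodup_zip_of_nodup {α β : Type*} :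
    ∀ {l₁ : List α} {l₂ : List β}, l₁.Nodup → (l₁.zip l₂).Nodup
  | [], _, _ => by simp
  | _ :: _, [], _ => by simp
  | a :: l₁, b :: l₂, h => by
    rw [List.nodup_cons] at h
    rw [List.zip_cons_cons, List.nodup_cons]
    exact ⟨fun hmem ↦ h.1 (List.of_mem_zip hmem).1, nodup_zip_of_nodup h.2⟩

/-- **No self-avoiding walk of the hexagonal lattice traverses a shell many times near a
controlled set of darts.** Let `w` be a path of the hexagonal lattice, embedded by `emb`, and
`ρ < R`. If every dart of `w` whose (embedded) segment meets the ball `B̄(x, ρ)` belongs to the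
finite set `S`, then the polygon of `w` does not traverse `D(x; ρ, R)` `2 (#S + 1) + 1` times:
its times in `B̄(x, ρ)` are covered by `#S + 1` intervals
(`hasOrdConnectedCover_preimage_polylineFrom`, `segMeetCount_map_le_card`, using that no dart is
repeated along a path), and `le_of_hasTraversals_of_hasOrdConnectedCover` applies.
(AB99 §1.a "short-distance cutoff", quantitative lattice form.) [cite: AizenmanBurchardDuke1999, §1.a] -/
theorem not_hasTraversals_toCurve_of_isPath {f g : HexVertex} {w : hexGraph.Walk f g}
    (hw : w.IsPath) (emb : HexVertex → ℂ) {x : ℂ} {ρ R : ℝ} (hρR : ρ < R)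
    (S : Finset (HexVertex × HexVertex))
    (hS : ∀ d ∈ w.darts, (segment ℝ (emb d.fst) (emb d.snd) ∩ closedBall x ρ).Nonempty →
      (d.fst, d.snd) ∈ S) :
    ¬ (⟨w.toCurve emb⟩ : RandomPlanarGeometry.Curve ℂ).HasTraversals (2 * (S.card + 1) + 1) x ρ R := by
  classical
  intro htr
  obtain ⟨l, hl⟩ : ∃ l, w.support = f :: l := ⟨w.support.tail, w.cons_tail_support.symm⟩
  have hfun : ∀ t, (⟨w.toCurve emb⟩ : RandomPlanarGeometry.Curve ℂ) t =
      (polylineFrom (emb f) (l.map emb)).2 t := by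
    intro t
    change polyline (w.support.map emb) t = _
    rw [hl]
    rfl
  have hcov := hasOrdConnectedCover_preimage_polylineFrom (convex_closedBall x ρ) (emb f)
    (l.map emb)
  have hpre : (⟨w.toCurve emb⟩ : RandomPlanarGeometry.Curve ℂ) ⁻¹' closedBall x ρ =
      (polylineFrom (emb f) (l.map emb)).2 ⁻¹' closedBall x ρ := by
    ext t
    rw [mem_preimage, mem_preimage, hfun]
  rw [← hpre] at hcov
  have hnd : ((f :: l).zip l).Nodup := nodup_zip_of_nodup (hl ▸ hw.support_nodup)
  have hcount : segMeetCount (closedBall x ρ) (emb f) (l.map emb) ≤ S.card := by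
    refine segMeetCount_map_le_card (closedBall x ρ) emb f l S hnd fun p hp hmeet ↦ ?_
    have hp' : p ∈ w.support.zip w.support.tail := by rw [hl]; exact hp
    obtain ⟨d, hd, h1, h2⟩ := w.exists_dart_of_mem_zip_support hp'
    have hpd : p = (d.fst, d.snd) := Prod.ext h1.symm h2.symm
    rw [hpd] at hmeet ⊢
    exact hS d hd hmeet
  have hle := le_of_hasTraversals_of_hasOrdConnectedCover hρR
    (hcov.mono (Nat.add_le_add_right hcount 1)) htr
  omega

/-- The support of a walk with distinct endpoints has at least two vertices. [folklore] -/
theorem two_le_length_support_of_ne {V : Type*} {G : SimpleGraph V} {u v : V} (w : G.Walk u v)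
    (h : u ≠ v) : 2 ≤ w.support.length := by
  cases w with
  | nil => exact absurd rfl h
  | cons h' w' =>
    rw [SimpleGraph.Walk.support_cons, List.length_cons, SimpleGraph.Walk.length_support]
    omega

/-- Every vertex of an exploration path is an endpoint of one of its darts (the path has
distinct endpoints, hence at least one dart). [folklore] -/
theorem exists_dart_of_mem_support {V : Type*} {G : SimpleGraph V} {u v : V} (w : G.Walk u v)
    (h : u ≠ v) {z : V} (hz : z ∈ w.support) : ∃ d ∈ w.darts, z = d.fst ∨ z = d.snd := by
  obtain ⟨p, hp, hzp⟩ := exists_mem_zip_of_mem w.support (two_le_length_support_of_ne w h) hz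
  obtain ⟨d, hd, h1, h2⟩ := w.exists_dart_of_mem_zip_support hp
  exact ⟨d, hd, by rwa [h1, h2]⟩

end HexGeometry

/-! ### Discharge of (C0) and (Clarge) -/

section Discharge

/-- **The trace of an exploration polygon lies within `δ` of the domain**: every vertex of the
polygon of an exploration path at mesh `δ ≥ 0` in a domain contained in `closedBall 0 r` lies in
`closedBall 0 (r + δ)`, hence so does the whole (piecewise-linear) trace. (Smirnov 2001, §2.)
[cite: Smirnov2001, §2] -/
theorem range_toCurve_subset_of_isExplorationPath {Dd : DiscreteDobrushin} {ω : SiteConfig (Site 2)}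
    {f g : HexVertex} {w : hexGraph.Walk f g} (hw : IsExplorationPath Dd ω w) (hδ : 0 ≤ Dd.δ)
    {r : ℝ} (hr : Dd.Ω ⊆ closedBall (0 : ℂ) r) :
    Set.range (w.toCurve fun F ↦ (Dd.δ : ℂ) * hexCenter F) ⊆ closedBall 0 (r + Dd.δ) := by
  set emb : HexVertex → ℂ := fun F ↦ (Dd.δ : ℂ) * hexCenter F with hemb
  -- every vertex of the polygon is within `r + δ` of the origin
  have hpt : ∀ F ∈ w.support, emb F ∈ closedBall (0 : ℂ) (r + Dd.δ) := by
    intro F hF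
    obtain ⟨d, hd, hFd⟩ := exists_dart_of_mem_support w hw.ne hF
    obtain ⟨v, hv, hf, hg, -, -⟩ := (hw.step d hd).exists_near hδ
    have hvr : triMeshPoint Dd.δ v ∈ closedBall (0 : ℂ) r :=
      hr (triMeshDomain_subset_triMeshVertices _ _ hv)
    have hF' : emb F ∈ closedBall (triMeshPoint Dd.δ v) Dd.δ := by
      rcases hFd with rfl | rfl
      exacts [hf, hg]
    rw [mem_closedBall] at hvr hF' ⊢
    linarith [dist_triangle (emb F) (triMeshPoint Dd.δ v) 0]
  obtain ⟨l, hl⟩ : ∃ l, w.support = f :: l := ⟨w.support.tail, w.cons_tail_support.symm⟩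
  change Set.range (polyline (w.support.map emb)) ⊆ _
  rw [hl, List.map_cons]
  change Set.range (polylineFrom (emb f) (l.map emb)).2 ⊆ _
  refine range_polylineFrom_subset (convex_closedBall 0 _) (hpt f (by rw [hl]; simp)) ?_
  intro p hp
  obtain ⟨F, hF, rfl⟩ := List.mem_map.1 hp
  exact hpt F (by rw [hl]; exact List.mem_cons_of_mem _ hF)

/-- **(C0) holds**: the short-distance cutoff of the hexagonal exploration polygon, proved from
the lattice bookkeeping above (`not_hasTraversals_toCurve_of_isPath` with the dart box of
half-width `14` about a site within `2δ` of the centre of the shell, and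
`range_toCurve_subset_of_isExplorationPath` for the trace). [cite: AizenmanBurchardDuke1999, §1.a] -/
theorem triExploration_shortDistanceCutoff_holds : triExploration_shortDistanceCutoff := by
  intro D
  obtain ⟨r, hr⟩ := D.isBounded.subset_closedBall (0 : ℂ)
  refine ⟨max r 0 + 1, 2 * (((2 * 14 + 1) ^ 2 * 2) ^ 2 + 1) + 1, by positivity, fun δ hδ ω ↦ ?_⟩
  obtain ⟨hδ0, hδ1⟩ := hδ
  have hδD : (dobrushinData D δ).δ = δ := rfl
  rcases explorationCurve_eq_const_or (dobrushinData D δ) ω with hconst | ⟨f₀, g₀, w, hw, hcurve⟩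
  · -- junk constant curve `0`
    have hc : triExplorationCurve D δ ω = RandomPlanarGeometry.Curve.const (0 : ℂ) := by
      rw [triExplorationCurve, hconst]
      rfl
    rw [hc]
    refine ⟨?_, fun x ρ R _ _ hρR ↦
      RandomPlanarGeometry.Curve.not_hasTraversals_const _ (by omega) hρR⟩
    rintro _ ⟨t, rfl⟩
    simp only [RandomPlanarGeometry.Curve.const_apply, mem_closedBall, dist_self]
    positivity
  · -- genuine exploration path
    have hc : triExplorationCurve D δ ω = ⟨w.toCurve fun F ↦ (δ : ℂ) * hexCenter F⟩ := by
      rw [triExplorationCurve, hcurve]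
      rfl
    rw [hc]
    refine ⟨?_, fun x ρ R hρ hρδ hρR ↦ ?_⟩
    · -- the trace lies within `1` of the domain
      have hr' : (dobrushinData D δ).Ω ⊆ closedBall (0 : ℂ) (max r 0) :=
        hr.trans (closedBall_subset_closedBall (le_max_left _ _))
      have h := range_toCurve_subset_of_isExplorationPath hw hδ0.le hr'
      rw [hδD] at h
      exact h.trans (closedBall_subset_closedBall (by linarith))
    · -- no `k₀` traversals of shells of inner radius `ρ ≤ δ`
      obtain ⟨c, hc⟩ := exists_site_norm_sub_le x hδ0
      rw [← card_hexDartBox c 14]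
      refine not_hasTraversals_toCurve_of_isPath hw.isPath _ hρR (hexDartBox c 14)
        fun d hd hmeet ↦ ?_
      obtain ⟨v, -, hf, hg, hnf, hng⟩ := (hw.step d hd).exists_near hδ0.le
      rw [hδD] at hf hg
      obtain ⟨z, hzseg, hzball⟩ := hmeet
      -- the meeting point is within `δ` of the mesh point of `v`, hence `v` is near `c`
      have hz : z ∈ closedBall (triMeshPoint δ v) δ :=
        (convex_closedBall _ _).segment_subset hf hg hzseg
      rw [mem_closedBall] at hz hzball
      have hvc : ‖triMeshPoint δ v - triMeshPoint δ c‖ ≤ 4 * δ := by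
        have := norm_sub_le (triMeshPoint δ v - x) (triMeshPoint δ c - x)
        rw [sub_sub_sub_cancel_right] at this
        rw [dist_eq_norm] at hz hzball
        have h1 : ‖triMeshPoint δ v - x‖ ≤ 2 * δ := by
          have := norm_sub_le (triMeshPoint δ v - z) (x - z)
          rw [sub_sub_sub_cancel_right] at this
          rw [norm_sub_rev] at hz
          linarith [norm_sub_rev x z]
        linarith
      have hvc' := norm_triEmbed_sub_le_of_triMeshPoint hδ0 hvc
      have key : ∀ F : HexVertex, ‖hexCenter F - triEmbed v‖ ≤ 1 → ∀ i, |F.1 i - c i| ≤ (14 : ℕ) := by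
        intro F hF i
        refine abs_sub_le_of_norm_hexCenter_sub_le (K := 5) ?_ (by norm_num) i
        have := norm_sub_le (hexCenter F - triEmbed v) (triEmbed c - triEmbed v)
        rw [sub_sub_sub_cancel_right] at this
        linarith [norm_sub_rev (triEmbed c) (triEmbed v)]
      exact mem_hexDartBox (key d.fst hnf) (key d.snd hng)

/-- **(Clarge) holds**: tightness of the interface laws for meshes `δ ∈ [δ₀, 1]`, by the
Aizenman–Burchard criterion with an *empty* large-scale hypothesis: at mesh `δ ≥ δ₀` every face
of an exploration step has its cell in a fixed box about the origin, so by
`not_hasTraversals_toCurve_of_isPath` no exploration polygon traverses any shell more than a fixed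
number `K₁` of times, and with the threshold `max k₀ K₁` the events in (H1) are empty while (H0)
is (C0). [cite: AizenmanBurchardDuke1999, §1.a] -/
theorem isTightMeasureSet_map_triInterface_of_le_holds :
    isTightMeasureSet_map_triInterface_of_le := by
  intro D δ₀ hδ₀
  by_cases hδ₀1 : 1 < δ₀
  · rw [Set.Icc_eq_empty (not_le.2 hδ₀1), Set.image_empty]
    exact isTightMeasureSet_empty
  rw [not_lt] at hδ₀1
  obtain ⟨r₀, k₀, hr₀, hcut⟩ := triExploration_shortDistanceCutoff_holds D
  obtain ⟨r, hr⟩ := D.isBounded.subset_closedBall (0 : ℂ)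
  set N : ℕ := ⌈2 * ((max r 0 / δ₀ + 1) + 2)⌉₊ with hN
  set K₁ : ℕ := 2 * (((2 * N + 1) ^ 2 * 2) ^ 2 + 1) + 1 with hK₁
  have hT : Set.Icc δ₀ 1 ⊆ Set.Ioc (0 : ℝ) 1 := fun δ hδ ↦ ⟨hδ₀.trans_le hδ.1, hδ.2⟩
  -- no polygon of mesh `δ ≥ δ₀` traverses any shell `K₁` times
  have hnone : ∀ δ ∈ Set.Icc δ₀ 1, ∀ (ω : SiteConfig (Site 2)) (x : ℂ) (ρ R : ℝ), ρ < R →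
      ¬ (triExplorationCurve D δ ω).HasTraversals K₁ x ρ R := by
    intro δ hδ ω x ρ R hρR
    have hδ0 : 0 < δ := hδ₀.trans_le hδ.1
    rcases explorationCurve_eq_const_or (dobrushinData D δ) ω with hconst | ⟨f₀, g₀, w, hw, hcurve⟩
    · have hc : triExplorationCurve D δ ω = RandomPlanarGeometry.Curve.const (0 : ℂ) := by
        rw [triExplorationCurve, hconst]
        rfl
      rw [hc]
      exact RandomPlanarGeometry.Curve.not_hasTraversals_const _ (by omega) hρR
    · have hc : triExplorationCurve D δ ω = ⟨w.toCurve fun F ↦ (δ : ℂ) * hexCenter F⟩ := by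
        rw [triExplorationCurve, hcurve]
        rfl
      rw [hc, hK₁, ← card_hexDartBox 0 N]
      refine not_hasTraversals_toCurve_of_isPath hw.isPath _ hρR (hexDartBox 0 N)
        fun d hd _ ↦ ?_
      obtain ⟨v, hv, -, -, hnf, hng⟩ := (hw.step d hd).exists_near hδ0.le
      have hvr : ‖triMeshPoint δ v‖ ≤ max r 0 := by
        have := hr (triMeshDomain_subset_triMeshVertices _ _ hv)
        rw [mem_closedBall, dist_zero_right] at this
        exact this.trans (le_max_left _ _)
      have hv' : ‖triEmbed v‖ ≤ max r 0 / δ₀ := by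
        rw [triMeshPoint, norm_mul, Complex.norm_real, Real.norm_eq_abs, abs_of_pos hδ0] at hvr
        rw [le_div_iff₀ hδ₀]
        calc ‖triEmbed v‖ * δ₀ ≤ ‖triEmbed v‖ * δ :=
              mul_le_mul_of_nonneg_left hδ.1 (norm_nonneg _)
          _ = δ * ‖triEmbed v‖ := mul_comm _ _
          _ ≤ max r 0 := hvr
      have key : ∀ F : HexVertex, ‖hexCenter F - triEmbed v‖ ≤ 1 → ∀ i, |F.1 i - (0 : Site 2) i| ≤ (N : ℕ) := by
        intro F hF i
        refine abs_sub_le_of_norm_hexCenter_sub_le (K := max r 0 / δ₀ + 1) ?_ (Nat.le_ceil _) i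
        rw [triEmbed_zero, sub_zero]
        have := norm_add_le (hexCenter F - triEmbed v) (triEmbed v)
        rw [sub_add_cancel] at this
        linarith
      exact mem_hexDartBox (key d.fst hnf) (key d.snd hng)
  have key := RandomPlanarGeometry.isTightMeasureSet_of_traversalBounds (E := ℂ)
    (isCompact_closedBall (0 : ℂ) r₀) (C := 9 * (r₀ + 2) ^ 2) (d := 2) zero_le_two
    (fun ρ hρ hρ1 ↦ RandomPlanarGeometry.exists_finset_card_le_cover_closedBall hr₀ ρ hρ hρ1)
    (Ω := fun _ ↦ SiteConfig (Site 2)) (fun _ ↦ triSitePercolation half)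
    (fun δ ω ↦ orientCurve D (explorationCurve (dobrushinData D δ) ω))
    (fun _ _ _ ↦ max k₀ K₁) (K := 0) (lam := 3) le_rfl (by norm_num) hT ?_ ?_
  · simpa only [triInterface_eq_comp] using key
  · -- (H0) from (C0)
    intro δ hδ
    refine ae_of_all _ fun ω ↦ ⟨?_, fun x ρ R hρ hρδ hρR htr ↦ ?_⟩
    · rw [curveRange_orientCurve]
      exact (hcut δ (hT hδ) ω).1
    · rw [hasTraversals_orientCurve_iff] at htr
      exact (hcut δ (hT hδ) ω).2 x ρ R hρ hρδ hρR (htr.of_le (le_max_left _ _))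
  · -- (H1): the events are empty
    intro δ hδ x ρ R _ hρR _
    have hempty : {ω | (orientCurve D (explorationCurve (dobrushinData D δ) ω)).HasTraversals
        (max k₀ K₁) x ρ R} = ∅ := by
      refine Set.subset_empty_iff.1 fun ω hω ↦ ?_
      rw [mem_setOf_eq, hasTraversals_orientCurve_iff] at hω
      exact hnone δ hδ ω x ρ R hρR (hω.of_le (le_max_right _ _))
    rw [hempty, measure_empty]
    exact bot_le

end Discharge

/-- **crit-perc.S26, triangular case, reduced to the single percolation estimate (C1).** With
(C0) and (Clarge) proved above, the tightness statement `isTightLaws_map_triInterface` follows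
from the traversal bound `triExploration_traversalBound` alone. (Aizenman–Burchard 1999, Thm 1.2
with Appendix A; Camia–Newman 2007, §5.) [cite: AizenmanBurchardDuke1999, Thm 1.2] -/
theorem isTightLaws_map_triInterface_of_traversalBound
    (h1 : ∀ D : RandomPlanarGeometry.DobrushinDomain, ∃ (k : ℂ → ℝ → ℝ → ℕ) (K lam δ₀ : ℝ),
      0 ≤ K ∧ 2 < lam ∧ 0 < δ₀ ∧ ∀ δ ∈ Set.Ioc (0 : ℝ) δ₀, (dobrushinData D δ).IsAdmissible →
        ∀ (x : ℂ) (ρ R : ℝ), δ ≤ ρ → ρ < R → R ≤ 1 →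
          triSitePercolation half {ω | (triExplorationCurve D δ ω).HasTraversals (k x ρ R) x ρ R} ≤
            ENNReal.ofReal (K * (ρ / R) ^ lam)) :
    isTightLaws_map_triInterface :=
  isTightLaws_map_triInterface_of_traversalBounds triExploration_shortDistanceCutoff_holds h1
    isTightMeasureSet_map_triInterface_of_le_holds

end CritPerc

end Literature.Probability.Percolation
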